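import Mathlib
import HarnessLib
import Summits.PneNP.PneNP.Theses.OverlapGapAlgebra
import Literature.Computability.Complexity.RandomKSatLowDegreeHardness

/-!
# PneNP / OverlapGapAlgebra — `SearchHardWindow` (crux stmt-PneNP-2460), Line A composition

Line A (card `approx-degree-ladder` of `Cruxes/SearchHardWindow/`, skeleton `Lines/Sketch.lean`)
reduces the crux `SearchHardWindow` (random `k`-SAT search is hard for all of P at the window
density `α_k = 5 · 2^k log k / k`) to three inputs:

* the NAMED FACT `Literature.Computability.Complexity.HuangSellke2025KSat` — Huang–Sellke 2025,
  arXiv:2501.06427 Cor. 3.21 (strong low-degree hardness of random `k`-SAT, deterministic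
  saturated special case): coordinate-degree-`o(n)`, linear-energy functions sign-solve
  `F_k(n, ⌊α_k n⌋)` with probability `→ 0`;
* the KERNEL (conjecture-grade, the non-relativizing ingredient; hypothesis `hKER`, spelled out):
  a polynomial-time `f` succeeding with count `≥ ε · #Φ` on a frequent set of `n` is matched there
  by a saturated sign-success `≥ ε/2 · #Φ` of such a low-degree function;
* `PositiveSatProbability` (item stmt-PneNP-2464, PROVED in
  `Theorems/OverlapGapAlgebraPositiveSatProbability.lean`; taken as a hypothesis here so that this
  file's import cone stays minimal).

This file is the registered stub `stub_lineAComposition` of the skeleton: the elementary glue.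
It does NOT close the crux (the kernel is open and P≠NP-strength: with the proved
`EvalRelationInP` and the route's `closes`, the crux implies `PneNP`).

Prover prover-line-stmt-PneNP-2460-0 (line lead), 2026-08-16.
-/

-- `Summit.PneNP.PneNP.…` is the tree's mandated namespace (summit = sub-problem name).
set_option linter.dupNamespace false

noncomputable section

namespace Summit.PneNP.PneNP.Theorems

open Finset Filter Asymptotics
open Literature.Computability.Complexity
open Summit.PneNP.PneNP.Theses.OverlapGapAlgebra
open scoped Classical

/-- Literal arrays over `n ≥ 1` variables form a nonempty type, so `#univ ≥ 1`. [folklore] -/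
theorem shw_one_le_card_litArray {m k n : ℕ} (hn : 1 ≤ n) :
    (1 : ℝ) ≤ Fintype.card (Fin m → Fin k → Fin n × Bool) := by
  have : Nonempty (Fin m → Fin k → Fin n × Bool) := ⟨fun _ _ => (⟨0, hn⟩, true)⟩
  exact_mod_cast Fintype.card_pos

/-- **Line A composition for the crux `SearchHardWindow`** (registered stub
`stub_lineAComposition` of `Cruxes/SearchHardWindow/Lines/Sketch.lean`): Huang–Sellke's strong
low-degree hardness of random `k`-SAT (named fact `HuangSellke2025KSat`) + the low-degree
simulation kernel `hKER` (open, conjecture-grade) + uniformly positive satisfiability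
(`PositiveSatProbability`, proved in the tree) imply `SearchHardWindow`. Proof: take
`k = max (max k₁ k₂) 3` and `α = 5 · 2^k log k / k`; the first conjunct is `PositiveSatProbability`
at `k`; if a poly-time `f` violated the hardness conjunct for some `ε > 0`, its success count would
be `> ε · #Φ` frequently, the kernel would give a saturated low-degree `F` sign-solving `≥ ε/2 · #Φ`
frequently, while the fact makes that count `≤ ε/4 · #Φ` eventually; with `#Φ ≥ 1` (`n ≥ 1`) this is
absurd. CONDITIONAL on the named fact and on the kernel hypothesis. -/
theorem stub_lineAComposition (hLDH : HuangSellke2025KSat)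
    (hKER : ∀ k : ℕ, 3 ≤ k → ∀ f : List Bool → List Bool, IsPolyTime f → ∀ ε : ℝ, 0 < ε →
      (∃ᶠ n : ℕ in atTop, ∀ m : ℕ, m = ⌊5 * 2 ^ k * Real.log k / k * n⌋₊ →
        ε * Fintype.card (Fin m → Fin k → Fin n × Bool) ≤
          ((univ.filter fun Φ : Fin m → Fin k → Fin n × Bool => ∀ i, ∃ j,
              (f (encodingCNF.encode (List.ofFn fun a => List.ofFn fun b =>
                (((Φ a b).1 : ℕ), (Φ a b).2)))).getD (Φ i j).1 false = (Φ i j).2).card : ℝ)) →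
      ∃ C : ℝ, 0 < C ∧ ∃ D : ℕ → ℕ, (fun n : ℕ => (D n : ℝ)) =o[atTop] (fun n : ℕ => (n : ℝ)) ∧
        ∃ F : (n : ℕ) → (m : ℕ) → (Fin m → Fin k → Fin n × Bool) → Fin n → ℝ,
          (∀ (n m : ℕ) (v : Fin n), IsCoordDegreeLE (D n)
              (fun y : Fin m × Fin k → Fin n × Bool => F n m (Function.curry y) v)) ∧
          (∀ n m : ℕ, m = ⌊5 * 2 ^ k * Real.log k / k * n⌋₊ →
              ∑ Φ : Fin m → Fin k → Fin n × Bool, ∑ v : Fin n, F n m Φ v ^ 2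
                ≤ C * n * Fintype.card (Fin m → Fin k → Fin n × Bool)) ∧
          ∃ᶠ n : ℕ in atTop, ∀ m : ℕ, m = ⌊5 * 2 ^ k * Real.log k / k * n⌋₊ →
            ε / 2 * Fintype.card (Fin m → Fin k → Fin n × Bool) ≤
              ((univ.filter fun Φ : Fin m → Fin k → Fin n × Bool =>
                  (∀ v : Fin n, 1 ≤ |F n m Φ v|) ∧
                  ∀ i : Fin m, ∃ j : Fin k, decide (0 ≤ F n m Φ (Φ i j).1) = (Φ i j).2).card : ℝ))
    (hPOS : PositiveSatProbability) : SearchHardWindow := by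
  obtain ⟨k₁, hLDH⟩ := hLDH
  obtain ⟨k₂, hSAT⟩ := hPOS
  unfold SearchHardWindow
  set k : ℕ := max (max k₁ k₂) 3 with hk
  have hk₁ : k₁ ≤ k := le_trans (le_max_left _ _) (le_max_left _ _)
  have hk₂ : k₂ ≤ k := le_trans (le_max_right _ _) (le_max_left _ _)
  have hk₃ : 3 ≤ k := le_max_right _ _
  refine ⟨k, 5 * 2 ^ k * Real.log k / k, hSAT k hk₂, ?_⟩
  intro f hf ε hε
  by_contra H
  -- frequent success `> ε`, as a count inequality
  have hfreq : ∃ᶠ n : ℕ in atTop, ∀ m : ℕ, m = ⌊5 * 2 ^ k * Real.log k / k * n⌋₊ →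
      ε * Fintype.card (Fin m → Fin k → Fin n × Bool) ≤
        ((univ.filter fun Φ : Fin m → Fin k → Fin n × Bool => ∀ i, ∃ j,
            (f (encodingCNF.encode (List.ofFn fun a => List.ofFn fun b =>
              (((Φ a b).1 : ℕ), (Φ a b).2)))).getD (Φ i j).1 false = (Φ i j).2).card : ℝ) := by
    rw [Filter.not_eventually] at H
    refine H.mono fun n hn => ?_
    intro m hm
    rw [Classical.not_forall] at hn
    obtain ⟨m', hm'⟩ := hn
    rw [Classical.not_imp, not_le] at hm'
    obtain ⟨hm'eq, hlt⟩ := hm'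
    subst hm; subst hm'eq
    set N := (Fintype.card (Fin ⌊5 * 2 ^ k * Real.log k / k * n⌋₊ → Fin k → Fin n × Bool) : ℝ)
    have hNpos : 0 < N := by
      rcases lt_or_ge 0 N with h | h
      · exact h
      · have hN0 : N = 0 := le_antisymm h (Nat.cast_nonneg _)
        rw [hN0, div_zero] at hlt
        exact absurd hlt (not_lt.2 hε.le)
    exact le_of_lt ((lt_div_iff₀ hNpos).1 hlt)
  obtain ⟨C, hC, D, hD, F, hdeg, hener, hFfreq⟩ := hKER k hk₃ f hf ε hε hfreq
  have hev := hLDH k hk₁ C hC D hD F hdeg hener (ε / 4) (by positivity)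
  obtain ⟨n, hn₁, hn₂, hn₃⟩ := (hFfreq.and_eventually (hev.and (eventually_ge_atTop 1))).exists
  have h₁ := hn₁ _ rfl
  have h₂ := hn₂ _ rfl
  have hcard := shw_one_le_card_litArray (m := ⌊5 * 2 ^ k * Real.log k / k * n⌋₊) (k := k) hn₃
  have : ε / 2 * (Fintype.card (Fin ⌊5 * 2 ^ k * Real.log k / k * n⌋₊ → Fin k → Fin n × Bool) : ℝ)
      ≤ ε / 4 * Fintype.card (Fin ⌊5 * 2 ^ k * Real.log k / k * n⌋₊ → Fin k → Fin n × Bool) :=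
    h₁.trans h₂
  nlinarith

end Summit.PneNP.PneNP.Theorems

end
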